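import Summits.ResolutionOfSingularities.ResolutionOfSingularities.Theorems.FrobeniusClosingSteerWords26SigmaResidualPar

/-!
# Crux `Steer` (stmt-ResolutionOfSingularities-16345), line `switching-dichotomy` — WORDS 27: §σ2.28 (a) the MEMBER-RELATIVE TORIC EXIT — (α″) words for F-A1 / F-A2 (`ToricExitAt` & co.) (HOIST of the registered skeleton r52 5a09c4c2f84a0135, l.1222–1492, inside `section HeightSplitTwo` with its `variable {K : Type} [Field K]`)

Holder res-L0-w41-lead-1 g6 on res-L0-w41-plan-1 RULING 47 (E1) / 104b; see `…Words01Core` for the hoist protocol (bodies byte for byte;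
`[cite: …]` / `[folklore]` tags on CLOSED `def … : Prop` words are written «(ref. …)» / «(folklore)» — GATE NOTE of `…Words02Stubs`;
cite keys inside `[cite:]` tags normalised to `references.bib` keys where needed, as in `…Words03Phases`).
Nothing here is a statement of the manuscript [claim: Hironaka2017, status: under-review]. OURS (candidates / vocabulary; AI review is
weaker than expert review).
-/

open Summit.ResolutionOfSingularities.ResolutionOfSingularities.Theses.FrobeniusClosing (IsolatedForcedTermination)
open Literature.AlgebraicGeometry.Resolution (IsAbhyankarPlace FGOver exists_ringKrullDim_eq_and_trdeg_eq
  trdeg_eq_trdeg_of_isFractionRing locAtCentre IsQuadraticTransformAlong SubringDominates IsRsopPart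
  LocalUniformization3 RelLocalUniformization CossartPiltant2019General)
open Summit.ResolutionOfSingularities.ResolutionOfSingularities.Theorems.SteerRankThinness
  (HasProperCoarsening concl_of_hasProperCoarsening rankOne_of_not_hasProperCoarsening)
open Summit.ResolutionOfSingularities.ResolutionOfSingularities.Theorems.PfaffLine

set_option linter.dupNamespace false

namespace Summit.ResolutionOfSingularities.ResolutionOfSingularities.Theorems.SwitchingDichotomy.Words

section SteeredTwo

open IsLocalRing
open Literature.AlgebraicGeometry.Resolution (IsLocalBlowupAlong IsQuadraticTransform IsExcellentRing)

variable {K : Type} [Field K]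


/-! #### §σ2.28 (a) — the MEMBER-RELATIVE TORIC EXIT: (α″) words for F-A1 / F-A2 (res-L0-w41-strat-2 g2; plan-1 RULINGS 102b/103/108;
drafted AGAINST r36 91a5a25981868d37, spliced before the unique `end HeightSplitTwo`)

WHY NOT res-type-028's (T3) AS THE TARGET OF (α″-rig). `SteerToricConcl.concl_of_toricChart` (T3) quantifies a TORUS CHART `y : Fin n → K` with
`AlgebraicIndependent k y` and `IsFractionRing k[y] K`; with `Algebra.trdeg k K = 4` this forces `K = k(y₀, …, y₃)` RATIONAL. `K = Frac A₀[t]` is fixed by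
the datum, and F-A1's hypotheses are étale-local at the centre (tri-3's specimen F transplanted into an `R 0` essentially étale over `k[u]_(u)` with
`Frac A₀` non-rational keeps its eternal period-5 run), so «eternal HIGH birth-wander ⇒ a torus chart of `K`» is false in general as a WORD (it covers
`A₀ = k[u]` only). (T3) stays the brick for that sub-class; the words below are its member-relative generalisation, with coefficients in the member.

THE WORDS. `ToricExitAt O R s n N`: at stage `N` of the run there are a regular system of parameters `x : Fin n → R N` (`span x = 𝔪`), a unimodular
`m ∈ ℤ^{(n+1)×(n+1)}` and, with the letters `y = (s N, x)`, monomials `z_j = ∏ i, y i ^ m j i` ALL in `O`, such that the model `(R N)[s N][z]` is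
REGULAR at the centre of `O`. PRODUCER `concl_of_toricExitAt` (PROVED here over the tree's X-machinery `SteeredExit.exists_model_of_tower` /
`mem_closure_insert_of_steps` and the `locAtCentre` sandwich of res-type-028's (T1)): a steered run + `ToricExitAt` ⇒ `Concl`. FRONTIER words
`BirthWanderToricTwoN` / `BranchWanderToricTwoN`: F-A1 / F-A2's binder blocks VERBATIM ⇒ `∃ N, ToricExitAt O R s 4 N`; forks hB₂ ⟸, hC₂ ⟸ PROVED;
`eternalSteeredRunTwo_of_slate10` = slate9' with the two toric words (the holder decides). The producer ignores the toric SHAPE (s.o.p., unimodular,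
monomial) — any finite family in `O` making the model regular would do; the shape is the CONJECTURE's content: «on the eternal birth-wander class ONE
unimodular monomial chart in (torsor letter, member parameters) at some stage resolves» (specimen F: `N = 0`, letters `(t, u₀, u₁, u₂, u₃)`, rows =
tri-3's regular cone chart of `toric-F.md` 68b7ba053cdb55c6 written in the five letters), which is what RULING 102 asks for: `Concl` is produced
WITHOUT termination of σ_top.

PROVER'S TOOL for the rigidity side (not an item). If the INITIAL FORM of `T^p − f_N` for the weight `(v(s N), v(x))` is torus-NONDEGENERATE over the
residue field (tree `Literature.AlgebraicGeometry.Resolution.NewtonNondegenerate.IsNondegenerateAlong`; Kouchnirenko / Boubakri–Greuel–Markwig §3; the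
valuative reading [cite: Teissier2014]; «the only obstruction to LU in characteristic p is defect» [cite: CutkoskyMourtada2019, §1]) then a regular cone
containing the weight gives `ToricExitAt` by the Jacobian criterion in the chart (`IsRegularLocalRing.quotient_span_singleton`). At `p = 2` a balanced
BINOMIAL initial form `u^{M₁} + u^{M₂}` is nondegenerate iff `M₁ ≢ M₂ (mod 2)` (F: `(0,1,0,0)` vs `(1,0,1,1)` ✓; `M₁ ≡ M₂` is a hidden square factor
`(1 + u^d)²`, removed by cleaning/stripping), and a MONOMIAL initial form `c·u^M`, `M ∉ 2ℤ⁴`, always exits (parity reduction to one odd coordinate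
keeps the weight in the cone: `t'² = z₁·w`, order 1). Honest residual of (α″): eternal HIGH birth-wander whose cleaned initial forms stay
torus-DEGENERATE at every stage; initial forms live in `4 − rr(ω) ≤ 3` effective variables (`ω^⊥ ∩ ℤ⁴`), so the degeneracy is a LOWER-dimensional
torsor singularity. Cheapest falsifier (tri-3's engine): an eternal in-regime HIGH birth-wander run with `≥ 3`-term initial forms degenerate at every
stage (`rr(ω) ∈ {2, 3}`).

(b) tri-2 v10 PART 3 notes: (n1) RECORDED — (Par-S) ≡ F-B-wild modulo (Par-P)'s emptiness theorem; the fork names, does not relocate (count slate9'/10's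
FRONTIER accordingly); (n2)/(n3) moot at r36 (re-cut leaves by name; hoists done). (c) «NoTangentialStepFour → PERSIST(4) → hG4» (RULING 108b): PEN ONLY
— nothing typed until tri-3's row R-S passes on idea-3 g5's files. OURS; candidates, not facts. -/

/-- **TORIC EXIT at stage `N`** (res-L0-w41-strat-2 §σ2.28 (a); the member-relative form of res-type-028's (T3)): a regular system of parameters
`x : Fin n → R N` (its span is the maximal ideal), a unimodular integer matrix `m` (`IsUnit m.det`) on the `n + 1` letters `y = (s N, x)` whose
monomials `z_j = ∏ i, y i ^ m j i` all lie in `O`, such that the model `(R N)[s N][z₀, …, z_n]` is REGULAR at the centre of `O`. Specimen F: `N = 0`,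
letters `(t, u₀, u₁, u₂, u₃)`. OURS. [cite: Teissier2014] [folklore] -/
def ToricExitAt (O : ValuationSubring K) (R : ℕ → Subring K) (s : ℕ → K) (n N : ℕ) : Prop :=
  ∃ (_ : IsLocalRing (R N)) (x : Fin n → K) (hx : ∀ i, x i ∈ R N) (m : Matrix (Fin (n + 1)) (Fin (n + 1)) ℤ),
    Ideal.span (Set.range fun i => (⟨x i, hx i⟩ : R N)) = maximalIdeal (R N) ∧ IsUnit m.det ∧
    (∀ j, (∏ i, (Matrix.vecCons (s N) x) i ^ m j i) ∈ O) ∧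
    IsRegularLocalRing (locAtCentre (Subring.closure ((R N : Set K) ∪
      insert (s N) (Set.range fun j => ∏ i, (Matrix.vecCons (s N) x) i ^ m j i))) O)

/-- **PRODUCER · a toric exit gives `Concl`** (res-L0-w41-strat-2 §σ2.28 (a); the X-machinery of res-D-pv-011's `SteeredExit` file): along a steered
run from `R 0 = (A₀)_{𝔪_O ∩ A₀}` (`A₀` finitely generated, `Frac A₀[t] = K`, `p ≠ 0`), a toric exit at stage `N` yields a finitely generated
`A ⊇ A₀` with `t ∈ A ⊆ O`, `Frac A = K`, regular at the centre of `O`: `A := A₁[s N, t, z]` for the finitely generated model `A₁` of the member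
(`SteeredExit.exists_model_of_tower`), whose local ring at the centre is the (regular) local ring of `(R N)[s N][z]` by the `locAtCentre` sandwich;
`t ∈ (R N)[s N]` by `SteeredExit.mem_closure_insert_of_steps`. The toric SHAPE of the exit is not used. PROVED. OURS. [folklore] -/
theorem concl_of_toricExitAt {p : ℕ} (hp : p ≠ 0) {n : ℕ}
    {k : Type} [Field k] [Algebra k K]
    (O : ValuationSubring K) (A₀ : Subalgebra k K) (h₀ : A₀.toSubring ≤ O.toSubring) (t : K)
    (hfg : A₀.FG) (hfr : IsFractionRing (Algebra.adjoin k (insert t (A₀ : Set K))) K)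
    (R : ℕ → Subring K) (P : (i : ℕ) → Ideal (R i)) (s : ℕ → K)
    (hR0 : R 0 = locAtCentre A₀.toSubring O) (hrun : IsSteeredRun O R P t p s) (N : ℕ)
    (hX : ToricExitAt O R s n N) : Concl O A₀ t := by
  classical
  obtain ⟨hs0, hst⟩ := hrun
  have hstep : ∀ i < N, Literature.AlgebraicGeometry.Resolution.IsLocalBlowup O (R i) (R (i + 1)) ∧
      ∃ x g : K, x ∈ R i ∧ g ∈ R i ∧ s i = x * s (i + 1) + g := fun i _ => by
    obtain ⟨_, _, -, hbl, x, g, ⟨⟨hx, -⟩, -, -⟩, hg, he⟩ := hst i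
    exact ⟨hbl.isLocalBlowup, x, g, hx, hg, he⟩
  obtain ⟨A₁, h₁, hle, hfg₁, hRN⟩ :=
    _root_.Summit.ResolutionOfSingularities.ResolutionOfSingularities.Theorems.SwitchingDichotomy.SteeredExit.exists_model_of_tower
      O A₀ h₀ hfg hR0 (N := N) fun i hi => (hstep i hi).1
  have htc : t ∈ Subring.closure (insert (s N) (R N : Set K)) :=
    _root_.Summit.ResolutionOfSingularities.ResolutionOfSingularities.Theorems.SwitchingDichotomy.SteeredExit.mem_closure_insert_of_steps
      hs0 (fun i hi => (hstep i hi).1.le) fun i hi => (hstep i hi).2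
  obtain ⟨-, x, hx, m, -, -, hzO, hreg⟩ := hX
  obtain ⟨_, hsN, -⟩ := hst N
  obtain ⟨_, hs0p, -⟩ := hst 0
  -- the letters
  set z : Fin (n + 1) → K := fun j => ∏ i, (Matrix.vecCons (s N) x) i ^ m j i with hzdef
  set B : Subring K := Subring.closure ((R N : Set K) ∪ insert (s N) (Set.range z)) with hBdef
  -- memberships in `O`
  have hRNO : R N ≤ O.toSubring := by
    rw [← hRN]; exact Literature.AlgebraicGeometry.Resolution.locAtCentre_le h₁
  have hsNO : s N ∈ O := mem_valuationSubring_of_pow_mem O hp (hRNO hsN)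
  have htO : t ∈ O := by
    rw [← hs0]
    refine mem_valuationSubring_of_pow_mem O hp ?_
    exact Literature.AlgebraicGeometry.Resolution.locAtCentre_le h₀ (hR0 ▸ hs0p)
  -- the model `A = A₁[s N, t, z]`
  set T : Finset K := insert (s N) (insert t (Finset.univ.image z)) with hTdef
  have hTO : (↑T : Set K) ⊆ O := by
    intro w hw
    simp only [hTdef, Finset.coe_insert, Finset.coe_image, Finset.coe_univ, Set.image_univ, Set.mem_insert_iff,
      Set.mem_range] at hw
    rcases hw with rfl | rfl | ⟨j, rfl⟩
    · exact hsNO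
    · exact htO
    · exact hzO j
  set A : Subalgebra k K := Algebra.adjoin k ((A₁ : Set K) ∪ ↑T) with hAdef
  have hAcl : A.toSubring = Subring.closure ((A₁ : Set K) ∪ ↑T) :=
    (Literature.AlgebraicGeometry.Resolution.closure_subalgebra_union_eq A₁ (↑T : Set K)).symm
  have hAO : A.toSubring ≤ O.toSubring := by
    rw [hAcl]; exact Subring.closure_le.mpr (Set.union_subset h₁ hTO)
  have hA₁A : A₁ ≤ A := fun w hw => Algebra.subset_adjoin (Or.inl hw)
  have hA₀A : A₀ ≤ A := hle.trans hA₁A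
  have hsT : s N ∈ (↑T : Set K) := by simp [hTdef]
  have htT : t ∈ (↑T : Set K) := by simp [hTdef]
  have hzT : ∀ j, z j ∈ (↑T : Set K) := fun j => by simp [hTdef]
  have htA : t ∈ A := Algebra.subset_adjoin (Or.inr htT)
  have hsA : s N ∈ A := Algebra.subset_adjoin (Or.inr hsT)
  have hzA : ∀ j, z j ∈ A := fun j => Algebra.subset_adjoin (Or.inr (hzT j))
  have hAfg : A.FG := Literature.AlgebraicGeometry.Resolution.fg_adjoin_subalgebra_union A₁ hfg₁ T
  haveI := hfr
  have hAfr : IsFractionRing A K :=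
    Literature.AlgebraicGeometry.Resolution.isFractionRing_subalgebra_of_le (Algebra.adjoin k (insert t (A₀ : Set K))) A
      (Algebra.adjoin_le (Set.insert_subset htA fun w hw => hA₀A hw))
  -- the sandwich `(A)_{𝔪_O ∩ A} = (B)_{𝔪_O ∩ B}` inside `K`
  have hBA : B ≤ locAtCentre A.toSubring O := by
    refine Subring.closure_le.mpr ?_
    rintro w (hw | hw)
    · rw [← hRN] at hw
      exact Literature.AlgebraicGeometry.Resolution.locAtCentre_mono O
        (show A₁.toSubring ≤ A.toSubring from fun v hv => hA₁A hv) hw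
    · rcases hw with rfl | ⟨j, rfl⟩
      · exact Literature.AlgebraicGeometry.Resolution.le_locAtCentre _ O hsA
      · exact Literature.AlgebraicGeometry.Resolution.le_locAtCentre _ O (hzA j)
  have hRB : (R N : Set K) ⊆ B := fun w hw => Subring.subset_closure (Or.inl hw)
  have hAB : A.toSubring ≤ locAtCentre B O := by
    rw [hAcl]
    refine Subring.closure_le.mpr ?_
    refine (Set.union_subset ?_ ?_).trans (Literature.AlgebraicGeometry.Resolution.le_locAtCentre B O)
    · intro w hw
      exact hRB (hRN ▸ Literature.AlgebraicGeometry.Resolution.le_locAtCentre A₁.toSubring O hw)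
    · intro w hw
      simp only [hTdef, Finset.coe_insert, Finset.coe_image, Finset.coe_univ, Set.image_univ, Set.mem_insert_iff,
        Set.mem_range] at hw
      rcases hw with rfl | rfl | ⟨j, rfl⟩
      · exact Subring.subset_closure (Or.inr (Set.mem_insert _ _))
      · have hsub : insert (s N) (R N : Set K) ⊆ (R N : Set K) ∪ insert (s N) (Set.range z) :=
          Set.insert_subset (Or.inr (Set.mem_insert _ _)) fun v hv => Or.inl hv
        exact Subring.closure_mono hsub htc
      · exact Subring.subset_closure (Or.inr (Set.mem_insert_of_mem _ ⟨j, rfl⟩))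
  have heq : locAtCentre A.toSubring O = locAtCentre B O := by
    refine le_antisymm ?_ ?_
    · simpa only [Literature.AlgebraicGeometry.Resolution.locAtCentre_locAtCentre] using
        Literature.AlgebraicGeometry.Resolution.locAtCentre_mono O hAB
    · simpa only [Literature.AlgebraicGeometry.Resolution.locAtCentre_locAtCentre] using
        Literature.AlgebraicGeometry.Resolution.locAtCentre_mono O hBA
  have hAreg : IsRegularLocalRing (locAtCentre A.toSubring O) := by rw [heq]; exact hreg
  exact ⟨A, hAO, hA₀A, htA, hAfg, hAfr,
    (Literature.AlgebraicGeometry.Resolution.isRegularLocalRing_locAtCentre_iff hAO).mp hAreg⟩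

/-- **F-A1-toric · BirthWanderToricTwoN** (FRONTIER, (α″) form of F-A1 — res-L0-w41-strat-2 §σ2.28 (a), plan-1 RULINGS 102b/103): F-A1's
hypotheses VERBATIM (normalised start, no dominant tail, eventually HIGH, infinitely many BIRTHS of height `≥ 2`) ⇒ a TORIC EXIT at some stage.
The rigidity conjecture behind (α″): the eternal birth-wander regime forces the cleaned radicands into monomial / torus-nondegenerate initial forms
in the member's parameters (tri-3's separated toric class R-O, specimens F, G; (ref. Teissier2014); the Abhyankar sub-case (ref. KnafKuhlmann2005)),
and one regular fan chart containing the valuation's weight then resolves. Why it might fail: an eternal HIGH birth-wander run whose cleaned initial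
forms stay torus-DEGENERATE at every stage (a lower-dimensional torsor singularity in `ω^⊥`, `rr(ω) ≤ 3`); in positive characteristic the
stabilisation of initial forms along a valuation is exactly where DEFECT bites (ref. CutkoskyMourtada2019, §1). OURS.
(ref. Teissier2014) (ref. CutkoskyMourtada2019, §1) (ref. CossartJannsenSaito2009, Thm. 5.25) -/
def BirthWanderToricTwoN : Prop :=
  ∀ p : ℕ, p = 2 →
    ∀ (k K : Type) [Field k] [CharP k p] [PerfectField k] [Field K] [Algebra k K]
    (O : ValuationSubring K) (A₀ : Subalgebra k K) (h₀ : A₀.toSubring ≤ O.toSubring) (t : K),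
    CoreDatum p 4 k K O A₀ h₀ t → ¬ HasProperCoarsening O →
    ∀ (R : ℕ → Subring K) (P : (i : ℕ) → Ideal (R i)) (s : ℕ → K),
      R 0 = locAtCentre A₀.toSubring O → NormalAt O (R 0) p t → IsSteeredRun O R P t p s →
      (¬ ∃ i₀ c : ℕ, 1 ≤ c ∧ IsDominantTail R P i₀ c) →
      (∃ i₀ : ℕ, ∀ i, i₀ ≤ i → IsHighOrderAt R s p i) →
      {j | IsRootStep R P j ∧ 2 ≤ (P j).height}.Infinite → ∃ N, ToricExitAt O R s 4 N

/-- **F-A2-toric · BranchWanderToricTwoN** (FRONTIER, (α″) form of F-A2 — res-L0-w41-strat-2 §σ2.28 (a)): F-A2's hypotheses VERBATIM (some centre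
of height `≥ 2` with infinitely many CHILDREN) ⇒ a TORIC EXIT at some stage. Why it might fail: as for `BirthWanderToricTwoN`; the germ at the
branching centre is `c`-dimensional, `c ∈ {2, 3}`, and its own initial forms may stay degenerate. OURS. (ref. Teissier2014) (ref. CossartPiltant2019, Thm. 1.4 (i)) -/
def BranchWanderToricTwoN : Prop :=
  ∀ p : ℕ, p = 2 →
    ∀ (k K : Type) [Field k] [CharP k p] [PerfectField k] [Field K] [Algebra k K]
    (O : ValuationSubring K) (A₀ : Subalgebra k K) (h₀ : A₀.toSubring ≤ O.toSubring) (t : K),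
    CoreDatum p 4 k K O A₀ h₀ t → ¬ HasProperCoarsening O →
    ∀ (R : ℕ → Subring K) (P : (i : ℕ) → Ideal (R i)) (s : ℕ → K),
      R 0 = locAtCentre A₀.toSubring O → NormalAt O (R 0) p t → IsSteeredRun O R P t p s →
      (¬ ∃ i₀ c : ℕ, 1 ≤ c ∧ IsDominantTail R P i₀ c) →
      (∃ i₀ : ℕ, ∀ i, i₀ ≤ i → IsHighOrderAt R s p i) →
      (∃ i, 2 ≤ (P i).height ∧ {j | IsChildStep R P i j}.Infinite) → ∃ N, ToricExitAt O R s 4 N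

/-- **Fork · F-A1 ⟸ F-A1-toric** (the producer `concl_of_toricExitAt` at `p = 2`). PROVED. OURS. [folklore] -/
theorem birthWanderHighConclTwoN_of_toric (h : BirthWanderToricTwoN) : BirthWanderHighConclTwoN := by
  intro p hp k K _ _ _ _ _ O A₀ h₀ t core hco R P s hR0 hN hrun hnd hhigh hinf
  obtain ⟨N, hX⟩ := h p hp k K O A₀ h₀ t core hco R P s hR0 hN hrun hnd hhigh hinf
  obtain ⟨hfg, htp, hfr, -⟩ := core
  exact concl_of_toricExitAt (by subst hp; decide) O A₀ h₀ t hfg hfr R P s hR0 hrun N hX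

/-- **Fork · F-A2 ⟸ F-A2-toric** (the producer `concl_of_toricExitAt` at `p = 2`). PROVED. OURS. [folklore] -/
theorem branchWanderHighConclTwoN_of_toric (h : BranchWanderToricTwoN) : BranchWanderHighConclTwoN := by
  intro p hp k K _ _ _ _ _ O A₀ h₀ t core hco R P s hR0 hN hrun hnd hhigh hbr
  obtain ⟨N, hX⟩ := h p hp k K O A₀ h₀ t core hco R P s hR0 hN hrun hnd hhigh hbr
  obtain ⟨hfg, htp, hfr, -⟩ := core
  exact concl_of_toricExitAt (by subst hp; decide) O A₀ h₀ t hfg hfr R P s hR0 hrun N hX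

/-- **slate10 (CANDIDATE — the holder decides)** = the T-line of record `eternalSteeredRunTwo_of_slate9'` with F-A1 / F-A2 replaced by their
(α″) toric forms `BirthWanderToricTwoN` / `BranchWanderToricTwoN` through the two forks. Same 12 binders; FRONTIER {F-A1-toric `hB₂`, F-A2-toric
`hC₂`, (Par-S) `hFBs`, G-TAME(4)₂ `hG4`, W(3)₂ `hW3`} · RUNG {`hG3`} · WORK {`hΘ`, `hFBp`, `hA3`, `hD3a`} · FACTS {`hL'`, `hCP'`}. Per tri-2's (n1)
reading the swap RELOCATES no difficulty by itself (the producer is WORK, proved); it NAMES the exit shape the rigidity prover must reach. Pure logic.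
OURS. [folklore] -/
theorem eternalSteeredRunTwo_of_slate10
    (hΘ : PointTailChainTwoN) (hFBp : StrippingTailPersistentConclTwoN) (hFBs : StrippingTailSwitchingConclTwoN)
    (hB₂ : BirthWanderHighConclTwoN) (hC₂ : BranchWanderHighConclTwoN)
    (hA3 : StrippedThreadTwoNH)
    (hG4 : ∀ e : ℕ, 2 ≤ e → NoEternalConstOrderIsolatedChainPerfect 2 4 (2 * e))
    (hG3 : ∀ e : ℕ, 2 ≤ e → NoEternalConstOrderIsolatedChainPerfect 2 3 (2 * e))
    (hW3 : ∀ e : ℕ, 2 ≤ e → NoEternalConstOrderIsolatedChainImperfect 2 3 (2 * e))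
    (hD3a : LowTowerExistsTwo)
    (hL' : Literature.AlgebraicGeometry.Resolution.Lipman1978NoEternalNormalisedBranch.{0})
    (hCP' : Literature.AlgebraicGeometry.Resolution.CossartPiltant2019LocalPermissible.{0}) : EternalSteeredRunTwo :=
  eternalSteeredRunTwo_of_slate9' hΘ hFBp hFBs hB₂ hC₂
    hA3 hG4 hG3 hW3 hD3a hL' hCP'


/-- **THE T-LINE OF RECORD (r38)** — `eternalSteeredRunTwo_of_slate9''` with hΘ `PointTailChainTwoN` FED BY NAME from res-D-pv-011's Θ♮
packaging `pointTailChainTwoN_of_recur` (Θ♮ engine `PointTail.not_noEternalStrippedChainHP_of_pointTail` p528265 + (L7) p528709 +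
`MembersPerfectResidue`), leaving in its slot the (Σ) binder `hrecur` «POINT STEPS RECUR» (= `PointStepsRecurTwoN`'s body, res-D-pv-011's
statement of record e16041012b506916; prover res-type-028, plan-1 RULINGS 110b/111a/114a):
T ⇐ FRONTIER {F-A1 `hB₂`, F-A2 `hC₂`, (Par-S) `hFBs`, G-TAME(4)₂ `hG4`, W(3)₂ `hW3`} · RUNG {G-perf(3)₂ `hG3`} · WORK {(Σ) `hrecur` (res-type-028),
D3a `hD3a` (res-D-pv-012)} · FACTS {hL′ Lipman 1978 (A), hCP′ CP 2019}. 10 binders. Pure logic. OURS. [folklore] -/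
theorem eternalSteeredRunTwo_of_slate9'''
    (hrecur : ∀ p : ℕ, p = 2 →
      ∀ (k K : Type) [Field k] [CharP k p] [PerfectField k] [Field K] [Algebra k K]
      (O : ValuationSubring K) (A₀ : Subalgebra k K) (h₀ : A₀.toSubring ≤ O.toSubring) (t : K),
      CoreDatum p 4 k K O A₀ h₀ t → ¬ HasProperCoarsening O →
      ∀ (R : ℕ → Subring K) (P : (i : ℕ) → Ideal (R i)) (s : ℕ → K),
        R 0 = locAtCentre A₀.toSubring O → NormalAt O (R 0) p t → IsSteeredRun O R P t p s →
        (¬ ∃ i₀ c : ℕ, 1 ≤ c ∧ IsDominantTail R P i₀ c) →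
        (∃ i₀ : ℕ, ∀ i, i₀ ≤ i → IsHighOrderAt R s p i) →
        ¬ HeightTwoStepsInfinite R P → {j | IsPosStep R P j}.Infinite →
        ∀ i₀ : ℕ, ∃ i, i₀ ≤ i ∧ IsPointStep R P i)
    (hFBs : StrippingTailSwitchingConclTwoN)
    (hB₂ : BirthWanderHighConclTwoN) (hC₂ : BranchWanderHighConclTwoN)
    (hG4 : ∀ e : ℕ, 2 ≤ e → NoEternalConstOrderIsolatedChainPerfect 2 4 (2 * e))
    (hG3 : ∀ e : ℕ, 2 ≤ e → NoEternalConstOrderIsolatedChainPerfect 2 3 (2 * e))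
    (hW3 : ∀ e : ℕ, 2 ≤ e → NoEternalConstOrderIsolatedChainImperfect 2 3 (2 * e))
    (hD3a : LowTowerExistsTwo)
    (hL' : Literature.AlgebraicGeometry.Resolution.Lipman1978NoEternalNormalisedBranch.{0})
    (hCP' : Literature.AlgebraicGeometry.Resolution.CossartPiltant2019LocalPermissible.{0}) : EternalSteeredRunTwo :=
  eternalSteeredRunTwo_of_slate9'' (pointTailChainTwoN_of_recur hrecur) hFBs hB₂ hC₂ hG4 hG3 hW3 hD3a hL' hCP'


/-- **THE T-LINE OF RECORD (r38; plan-1 RULING 115b «slate10»)** — `eternalSteeredRunTwo_of_slate9''` with F-A1 / F-A2 in their (α″) MEMBER-RELATIVE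
TORIC forms (res-L0-w41-strat-2 §σ2.28 (a): `BirthWanderToricTwoN` / `BranchWanderToricTwoN` through the PROVED forks
`birthWanderHighConclTwoN_of_toric` / `branchWanderHighConclTwoN_of_toric` over `concl_of_toricExitAt`) and hΘ FED by res-D-pv-011's
`pointTailChainTwoN_of_recur` leaving the (Σ) binder `hrecur`:
T ⇐ FRONTIER {F-A1-toric `hB₂`, F-A2-toric `hC₂`, (Par-S) `hFBs`, G-TAME(4)₂ `hG4` (leaves at (e-V), RULING 114b), W(3)₂ `hW3`} · RUNG {G-perf(3)₂ `hG3`} ·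
WORK {(Σ) `hrecur` (res-type-028), D3a `hD3a` (res-D-pv-012)} · FACTS {hL′, hCP′}. 10 binders (strat-2's own `eternalSteeredRunTwo_of_slate10` above
keeps the 12-binder shape on `…_of_slate9'`). Pure logic. OURS. [folklore] -/
theorem eternalSteeredRunTwo_of_slate10'
    (hrecur : ∀ p : ℕ, p = 2 →
      ∀ (k K : Type) [Field k] [CharP k p] [PerfectField k] [Field K] [Algebra k K]
      (O : ValuationSubring K) (A₀ : Subalgebra k K) (h₀ : A₀.toSubring ≤ O.toSubring) (t : K),
      CoreDatum p 4 k K O A₀ h₀ t → ¬ HasProperCoarsening O →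
      ∀ (R : ℕ → Subring K) (P : (i : ℕ) → Ideal (R i)) (s : ℕ → K),
        R 0 = locAtCentre A₀.toSubring O → NormalAt O (R 0) p t → IsSteeredRun O R P t p s →
        (¬ ∃ i₀ c : ℕ, 1 ≤ c ∧ IsDominantTail R P i₀ c) →
        (∃ i₀ : ℕ, ∀ i, i₀ ≤ i → IsHighOrderAt R s p i) →
        ¬ HeightTwoStepsInfinite R P → {j | IsPosStep R P j}.Infinite →
        ∀ i₀ : ℕ, ∃ i, i₀ ≤ i ∧ IsPointStep R P i)
    (hFBs : StrippingTailSwitchingConclTwoN)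
    (hB₂ : BirthWanderHighConclTwoN) (hC₂ : BranchWanderHighConclTwoN)
    (hG4 : ∀ e : ℕ, 2 ≤ e → NoEternalConstOrderIsolatedChainPerfect 2 4 (2 * e))
    (hG3 : ∀ e : ℕ, 2 ≤ e → NoEternalConstOrderIsolatedChainPerfect 2 3 (2 * e))
    (hW3 : ∀ e : ℕ, 2 ≤ e → NoEternalConstOrderIsolatedChainImperfect 2 3 (2 * e))
    (hD3a : LowTowerExistsTwo)
    (hL' : Literature.AlgebraicGeometry.Resolution.Lipman1978NoEternalNormalisedBranch.{0})
    (hCP' : Literature.AlgebraicGeometry.Resolution.CossartPiltant2019LocalPermissible.{0}) : EternalSteeredRunTwo :=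
  eternalSteeredRunTwo_of_slate9''' hrecur hFBs hB₂ hC₂
    hG4 hG3 hW3 hD3a hL' hCP'


end SteeredTwo

end Summit.ResolutionOfSingularities.ResolutionOfSingularities.Theorems.SwitchingDichotomy.Words
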